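import Literature.AlgebraicGeometry.Resolution.LocalBlowup
import Mathlib.RingTheory.Adjoin.FG
import Mathlib.RingTheory.Localization.AtPrime.Basic
import Mathlib.RingTheory.Noetherian.Basic
import Mathlib.RingTheory.FiniteType
import Mathlib.RingTheory.Localization.Submodule
import HarnessLib

/-!
# Route `HomologicalConductor`, crux `Globalisation` (stmt-ResolutionOfSingularities-16486), line `birth_HomologicalConductor` (v2) — stub `stub_chartStep`

One step of the tower of models: for a finitely generated `k`-subalgebra `D ⊆ O` of the field `K`
(`O` a valuation ring of `K`) and `B` the `k`-subalgebra with `B.toSubring = locAtCentre D O`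
(`D` localised at the centre of `O`, read inside `K`), the blow-up chart of an ideal `I` of `B`
at an element of minimal `O`-value needs only finitely many new generators modulo units of the
next local ring (Novacoski–Spivakovsky 2014, Def. 2.11: along `I = (u₀, …, u_q)` with `ν(u₀)`
minimal, `R' = R[u₁/u₀, …, u_q/u₀]`).

Proof: `B ≅ D_{𝔪_O ∩ D}` is Noetherian (`D` is a finitely generated algebra over the field `k`,
and `locAtCentre D O` is its localisation at the centre), so `I = (g₁, …, g_r)`.  If no element
of `I` has minimal value the chart set is empty (`t = ∅`).  Otherwise fix such an `x₀` and take
`t = {gᵢ / x₀}`: each `gᵢ / x₀` is a chart element, and for a chart element `c / x` (with `x` of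
minimal value too) `c / x₀ ∈ L := locAtCentre (D[t]) O` by writing `c = Σ bᵢ gᵢ` (`bᵢ ∈ B ⊆ L`),
while `x / x₀ ∈ L` is an `O`-unit, so `x₀ / x ∈ L` and `c / x = (c / x₀) (x₀ / x) ∈ L`.
-/

-- single-problem summit: the doubled namespace component `ResolutionOfSingularities` is forced
set_option linter.dupNamespace false

namespace Summit.ResolutionOfSingularities.ResolutionOfSingularities.Theorems.HomologicalConductorGlobalisation

open Literature.AlgebraicGeometry.Resolution

/-- In a valuation ring `O` of `K`: if `s ≠ 0`, `s ∈ O` and `s⁻¹ ∈ O` then `O.valuation s = 1`.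
[folklore] -/
private theorem chartStep_valuation_eq_one {K : Type} [Field K] (O : ValuationSubring K)
    {s : K} (hs : s ∈ O) (hs0 : s ≠ 0) (hs' : s⁻¹ ∈ O) : O.valuation s = 1 := by
  -- adapted from `risoGlob_inv_mem_valuationSubring_iff`
  -- (Theorems/RisoStrataRisoGlobalisationCentres.lean)
  rw [← O.valuation_le_one_iff, map_inv₀] at hs'
  have hv0 : O.valuation s ≠ 0 := by rwa [Ne, map_eq_zero]
  have hle : O.valuation s ≤ 1 := (O.valuation_le_one_iff s).mpr hs
  rw [inv_le_one₀ (zero_lt_iff.mpr hv0)] at hs'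
  exact le_antisymm hle hs'

/-- `B` with `B.toSubring = D_{𝔪_O ∩ D}` is Noetherian when `D ⊆ O` is a finitely generated
`k`-subalgebra of `K` (Hilbert basis theorem and Noetherianity of localisations). [folklore] -/
private theorem chartStep_isNoetherianRing {k K : Type} [Field k] [Field K] [Algebra k K]
    (O : ValuationSubring K) (D : Subalgebra k K) (hD : D.FG) (hDO : D.toSubring ≤ O.toSubring)
    (B : Subalgebra k K) (hB : B.toSubring = locAtCentre D.toSubring O) :
    IsNoetherianRing ↥B := by
  haveI : Algebra.FiniteType k ↥D := D.fg_iff_finiteType.mp hD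
  haveI hDn : IsNoetherianRing ↥D := Algebra.FiniteType.isNoetherianRing k ↥D
  haveI : IsNoetherianRing ↥D.toSubring := hDn
  haveI := isLocalization_locAtCentre hDO
  haveI hL : IsNoetherianRing ↥(locAtCentre D.toSubring O) :=
    IsLocalization.isNoetherianRing (subringCentre D.toSubring O hDO).primeCompl _ inferInstance
  have hBn : IsNoetherianRing ↥B.toSubring :=
    isNoetherianRing_of_ringEquiv _ (RingEquiv.subringCongr hB).symm
  exact hBn

/-- The heart of the chart step: if `B ⊆ L = A_{𝔪_O ∩ A}`, `I = (g)` is an ideal of `B`,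
`x₀ ∈ I` is nonzero of minimal `O`-value and every `gᵢ / x₀ ∈ L`, then every chart element
`c / x` (`c, x ∈ I`, `x` of minimal value) lies in `L`. [cite: NovacoskiSpivakovsky2014, Def. 2.11] -/
private theorem chartStep_subset {k K : Type} [Field k] [Field K] [Algebra k K]
    (O : ValuationSubring K) {A : Subring K} (B : Subalgebra k K)
    (hBL : ∀ z ∈ B, z ∈ locAtCentre A O) (I : Ideal ↥B) (g : Finset ↥B)
    (hg : Submodule.span ↥B (↑g : Set ↥B) = I) {x₀ : K}
    (hx₀S : x₀ ∈ ((↑) : ↥B → K) '' (I : Set ↥B)) (hx₀0 : x₀ ≠ 0)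
    (hmin₀ : ∀ c' ∈ ((↑) : ↥B → K) '' (I : Set ↥B), c' * x₀⁻¹ ∈ O)
    (htL : ∀ b ∈ g, (b : K) * x₀⁻¹ ∈ locAtCentre A O) :
    {y : K | ∃ c ∈ (((↑) : ↥B → K) '' (I : Set ↥B)), ∃ x ∈ (((↑) : ↥B → K) '' (I : Set ↥B)),
      x ≠ 0 ∧ (∀ c' ∈ (((↑) : ↥B → K) '' (I : Set ↥B)), c' * x⁻¹ ∈ O) ∧ y = c * x⁻¹} ⊆
      (locAtCentre A O : Set K) := by
  -- key: `c / x₀ ∈ L` for every `c ∈ I`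
  have key : ∀ c ∈ I, (c : K) * x₀⁻¹ ∈ locAtCentre A O := by
    intro c hc
    rw [← hg] at hc
    induction hc using Submodule.span_induction with
    | mem b hb => exact htL b hb
    | zero =>
      rw [ZeroMemClass.coe_zero, zero_mul]
      exact Subring.zero_mem _
    | add a b _ _ ha hb =>
      rw [AddMemClass.coe_add, add_mul]
      exact Subring.add_mem _ ha hb
    | smul r a _ ha =>
      rw [smul_eq_mul, MulMemClass.coe_mul, mul_assoc]
      exact Subring.mul_mem _ (hBL _ r.2) ha
  rintro y ⟨c, ⟨c₁, hc₁, rfl⟩, x, hxS, hx0, hmin, rfl⟩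
  obtain ⟨x₁, hx₁, rfl⟩ := hxS
  have hu : (x₁ : K) * x₀⁻¹ ∈ locAtCentre A O := key x₁ hx₁
  have huO : (x₁ : K) * x₀⁻¹ ∈ O := hmin₀ _ ⟨x₁, hx₁, rfl⟩
  have huO' : ((x₁ : K) * x₀⁻¹)⁻¹ ∈ O := by
    rw [mul_inv_rev, inv_inv]
    exact hmin x₀ hx₀S
  have hv : O.valuation ((x₁ : K) * x₀⁻¹) = 1 :=
    chartStep_valuation_eq_one O huO (mul_ne_zero hx0 (inv_ne_zero hx₀0)) huO'
  have hinv : x₀ * (x₁ : K)⁻¹ ∈ locAtCentre A O := by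
    have := inv_mem_locAtCentre hu hv
    rwa [mul_inv_rev, inv_inv] at this
  have hcx : (c₁ : K) * (x₁ : K)⁻¹ = ((c₁ : K) * x₀⁻¹) * (x₀ * (x₁ : K)⁻¹) := by
    rw [mul_assoc, ← mul_assoc x₀⁻¹, inv_mul_cancel₀ hx₀0, one_mul]
  change (c₁ : K) * (x₁ : K)⁻¹ ∈ locAtCentre A O
  rw [hcx]
  exact Subring.mul_mem _ (key c₁ hc₁) hinv

/-- **Chart step (finitely many chart generators suffice modulo units of the next local ring).**
For a finitely generated `k`-subalgebra `D ⊆ O` of `K`, `B` with `B.toSubring = locAtCentre D O`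
and an ideal `I` of `B`, there is a finite set `t` of chart elements `c / x` (`c, x ∈ I`, `x ≠ 0`
of minimal `O`-value on `I`) such that all chart elements lie in `locAtCentre (D[t]) O`.
[cite: NovacoskiSpivakovsky2014, Def. 2.11] -/
theorem stub_chartStep {k K : Type} [Field k] [Field K] [Algebra k K] (O : ValuationSubring K)
    (D : Subalgebra k K) (hD : D.FG) (hDO : D.toSubring ≤ O.toSubring) (B : Subalgebra k K)
    (hB : B.toSubring = Literature.AlgebraicGeometry.Resolution.locAtCentre D.toSubring O)
    (I : Ideal ↥B) :
    ∃ t : Finset K, (↑t : Set K) ⊆ {y : K | ∃ c ∈ (((↑) : ↥B → K) '' (I : Set ↥B)), ∃ x ∈ (((↑) : ↥B → K) '' (I : Set ↥B)), x ≠ 0 ∧ (∀ c' ∈ (((↑) : ↥B → K) '' (I : Set ↥B)), c' * x⁻¹ ∈ O) ∧ y = c * x⁻¹} ∧ {y : K | ∃ c ∈ (((↑) : ↥B → K) '' (I : Set ↥B)), ∃ x ∈ (((↑) : ↥B → K) '' (I : Set ↥B)), x ≠ 0 ∧ (∀ c' ∈ (((↑) : ↥B → K) '' (I : Set ↥B)),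 c' * x⁻¹ ∈ O) ∧ y = c * x⁻¹} ⊆ (Literature.AlgebraicGeometry.Resolution.locAtCentre (Algebra.adjoin k ((D : Set K) ∪ ↑t)).toSubring O : Set K) := by
  classical
  -- `B ≅ D_{𝔪_O ∩ D}` is Noetherian, so `I` is finitely generated
  haveI := chartStep_isNoetherianRing O D hD hDO B hB
  obtain ⟨g, hg⟩ : I.FG := IsNoetherian.noetherian I
  by_cases hex : ∃ x ∈ ((↑) : ↥B → K) '' (I : Set ↥B), x ≠ 0 ∧
      ∀ c' ∈ ((↑) : ↥B → K) '' (I : Set ↥B), c' * x⁻¹ ∈ O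
  swap
  · -- no element of minimal value: the chart set is empty
    refine ⟨∅, by simp, ?_⟩
    rintro y ⟨c, _, x, hx, hx0, hmin, rfl⟩
    exact absurd ⟨x, hx, hx0, hmin⟩ hex
  obtain ⟨x₀, hx₀S, hx₀0, hmin₀⟩ := hex
  refine ⟨g.image (fun b : ↥B => (b : K) * x₀⁻¹), ?_, ?_⟩
  · -- the new generators `gᵢ / x₀` are chart elements
    intro y hy
    rw [Finset.coe_image] at hy
    obtain ⟨b, hb, rfl⟩ := hy
    refine ⟨(b : K), ⟨b, ?_, rfl⟩, x₀, hx₀S, hx₀0, hmin₀, rfl⟩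
    rw [SetLike.mem_coe, ← hg]
    exact Submodule.subset_span hb
  · -- every chart element lies in the next local ring `locAtCentre (D[t]) O`
    have hDL : D.toSubring ≤
        (Algebra.adjoin k ((D : Set K) ∪ ↑(g.image (fun b : ↥B => (b : K) * x₀⁻¹)))).toSubring :=
      fun z hz => Algebra.subset_adjoin (Set.mem_union_left _ hz)
    have hBL : ∀ z ∈ B, z ∈ locAtCentre
        (Algebra.adjoin k ((D : Set K) ∪ ↑(g.image (fun b : ↥B => (b : K) * x₀⁻¹)))).toSubring O := by
      intro z hz
      have hz' : z ∈ B.toSubring := hz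
      rw [hB] at hz'
      exact locAtCentre_mono O hDL hz'
    refine chartStep_subset O B hBL I g hg hx₀S hx₀0 hmin₀ ?_
    intro b hb
    refine le_locAtCentre _ O (Algebra.subset_adjoin (Set.mem_union_right _ ?_))
    rw [Finset.coe_image]
    exact Set.mem_image_of_mem _ hb

end Summit.ResolutionOfSingularities.ResolutionOfSingularities.Theorems.HomologicalConductorGlobalisation
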